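import Summits.QuantumFields.YangMills.Theorems.PoincareLipschitzTwoSidedOfConcentrationStep
import Summits.QuantumFields.YangMills.Theorems.LocalInsertionHistoryTailOfInsertionLPerPlaquette
import HarnessLib

/-!
# Line «local_insertion» on crux `HistoryTailL` (stmt-QuantumFields-19936) — THE CARD'S ENGINE (E3) BY KERNEL, WITH ITS CENTRING ROW:
# massless-rate concentration (K1) ∧ window-Lipschitz (K2) ∧ MEDIAN AT SCALE `g_{K−j}` ⇒ the Gaussian window tail ⇒ the insertion bound

Cell `ym3-torus` (YM ladder rung R3 = continuum SU(2) Yang–Mills on the three-torus — a RUNG, NOT the Clay problem: not d = 4, not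
infinite volume, not a mass gap), width seat `ym-ust-19936-w3` gen 11, `--supports stmt-QuantumFields-19936 --as helper`; LEAD ★w1-19936 g6
lettering (23:03:33Z: the MEDIAN row displayed, the mean form as a Markov corollary).  THEOREMS ONLY, definition-free.
HONEST FRAMING: a CONDITIONAL one-height step.  Its hypotheses `hK1` (the text of crux `PoincareLipschitz.MesoscopicConcentrationL`,
stmt-QuantumFields-23532, at one `(F, γ, K)` — verbatim as in ✓`TwoSidedOfConcentration.local_step`), `hK2` (the text of crux
`PoincareLipschitz.BlockLipschitzL`, stmt-23533, at one plaquette; at `j = 1` it is the THEOREM ✓`stub_levelOneLipschitz`, p674322) and `hMed`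
(NEW, not an item: «with probability ≥ ½ the local history at `a` is good AND `dist1(Ū^j(∂a)) ≤ m·g_{K−j}`», i.e. the block flux has its
MEDIAN AT SCALE `g`) are NOT in the tree at any height.  Nothing of `LocalInsertionL` (23607), the glue 23608, the stubs of
`Cruxes/HistoryTailL/Lines/local_insertion.lean`, the crux `HistoryTailL` or any summit statement is proved.

WHY (located point, adopted by LEAD for card v1.23).  The line card's engine (E3) reads «LINE 15's `MesoscopicConcentrationL ∧ BlockLipschitzL`
imply `LocalInsertionL`».  As printed this is CENTRING-DEFICIENT: line 15's shared first-moment item is `MeanDeviationL` (`E dist1 ≤ ½θ`,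
`θ = g·p(g)`), and K1 ∧ K2 ∧ MeanDeviationL are consistent with `dist1(Ū^j(∂a)) ≈ θ/2`, under which the capped moment of `LocalInsertionL` is
`≈ e^{εp/2}`, not K-uniform.  What the insertion currency needs is the first moment — or, weakest, the MEDIAN — AT SCALE `g_{K−j}`; with it,
K1 ∧ K2 give a K-, j- and plaquette-uniform GAUSSIAN tail of the normalised flux on the window (below), hence (file A,
✓`MomentOfWindowTail.insertionIntegral_le_of_gaussTail`) the fixed-`ε` capped moment for EVERY `ε ≥ 0`.

WHAT (one instance `(F, γ ≤ ½, K, j, a)` with `j + 2 ≤ K`; `g = g_{K−j} = √(γL^{−(K−j)})`, `f = dist1(Ū^j(∂a))`, `G = G(a,j)` the local small-history event).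
* §1 `beta_mul_coupling_sq`: `β_K·g_{K−j}² = L^j`; `mul_exp_neg_two_mul_lt_half`: `Cc·e^{−2Cc} < ½`.
* §2 ★★`windowTail_step`: `hK1 ∧ hK2 ∧ hMed : ½ ≤ Gibbs_K(G ∩ {f ≤ m·g})` ⇒ for every `n : ℕ` with `2(m + r₀) ≤ n`,
  `Gibbs_K(G ∩ {n·g ≤ f}) ≤ Cc·exp(−(cc/(1156(CL+1)²))·n²)`, `r₀ := (CL+1)·√(578·Cc/cc)`.  Proof: McShane extension `g_n` of `f|_G` CAPPED AT
  `n·g` in the box link pseudometric with `Λ = (CL+1)/√(L^j)` (✓`exists_capped_infConvolution`, ✓`boxLinkDist_*`): measurable, gauge invariant,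
  local in the box of side `17L^j` (`≤ β_K`), `Λ`-Lipschitz in the full link metric, `0 ≤ g_n ≤ n·g`, `g_n ≤ f` on `G`, `g_n = n·g` on
  `G ∩ {n·g ≤ f}`; the exponent of `hK1` at deviation `s·g` is `cc·β_K(s·g)²/((17L^j)²Λ²) = (cc/(289(CL+1)²))·s²` by §1 (j-UNIFORM); LOWER tail
  of `g_n` (K1 for `−g_n`) at `s = r₀` has mass `≤ Cc·e^{−2Cc} < ½`, so the median row forces `E g_n ≤ (m + r₀)·g`; UPPER tail at `s = n/2`.
* §3 ★`median_of_mean`: the MEAN form `∫ f ∂Gibbs_K ≤ (m/4)·g` ∧ `Gibbs_K(Gᶜ) ≤ ¼` (`m > 0`) gives `hMed` (Markov).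
* (by-name layer, separate file `LocalInsertionInsertionStepOfConcentration.lean`, in the route cone) `insertion_step` /
  `insertion_step_of_mean`: §2/§3 + file A's Gaussian-tail adapter ⇒ the LocalInsertionL integrand bound for EVERY `ε ≥ 0`.
ROUTE-INDEPENDENT: this file imports no `Theses` module (the objects are spelled out).
[cite: Balaban1985UV3, (3) p.256, (7) p.257 and (71) p.273]
-/

set_option autoImplicit false

noncomputable section

open scoped BigOperators
open MeasureTheory Set
open Literature.MathematicalPhysics.QuantumFieldTheory.Balaban1983to89
open Literature.MathematicalPhysics.QuantumFieldTheory.Balaban1983to89.T3ContinuumYM3Torus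
open Literature.MathematicalPhysics.QuantumFieldTheory.Balaban1983to89.T3UnitScaleTilt
open Literature.MathematicalPhysics.QuantumFieldTheory.Balaban1983to89.T3UnitLawDensityEML
open Literature.MathematicalPhysics.QuantumFieldTheory.Balaban1983to89.T3OrbitAverage
open Summit.QuantumFields.YangMills.Theorems.PoincareLipschitz.TwoSidedOfConcentration
  (exists_capped_infConvolution boxLinkDist_nonneg boxLinkDist_self boxLinkDist_comm boxLinkDist_triangle continuous_boxLinkDist
    boxLinkDist_gaugeAct boxLinkDist_congr_left boxLinkDist_le_linkDist gaugeAct_gaugeAct_inv dist1_plaqHol_iter_gaugeAct)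
open Summit.QuantumFields.YangMills.Theorems.LocalInsertion.HistoryTailOfInsertion (measurable_flux measurableSet_localGood)
open Literature.MathematicalPhysics.QuantumFieldTheory.Balaban1983to89.T4PairDerivBridge (dist1_le_two_specialUnitaryGroup)

namespace Summit.QuantumFields.YangMills.Theorems.LocalInsertion.WindowTailOfConcentration

/-! ## §1 Bookkeeping -/

/-- `β_K · g_{K−j}² = L^j`: the massless box factor of K1 against the variance scale of the block flux. [cite: Balaban1985UV3, (3) p.256] -/
theorem beta_mul_coupling_sq (F : T3Family) {γ : ℝ} (hγ : 0 < γ) {K j : ℕ} (hjK : j ≤ K) :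
    (F.scheme ℰp γ).β K * Real.sqrt (γ * ((F.L : ℝ)⁻¹) ^ (K - j)) ^ 2 = (F.L : ℝ) ^ j := by
  have hL0 : (0 : ℝ) < F.L := by exact_mod_cast lt_trans zero_lt_one F.hL.2
  have hx : 0 < γ * ((F.L : ℝ)⁻¹) ^ (K - j) := mul_pos hγ (pow_pos (inv_pos.2 hL0) _)
  have hK : K - j + j = K := Nat.sub_add_cancel hjK
  have hadd := Summit.QuantumFields.YangMills.Theorems.LocalInsertion.HistoryTailOfInsertion.scheme_β_add F γ (K - j) j
  rw [hK] at hadd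
  have hβ : (F.scheme ℰp γ).β (K - j) = (γ * ((F.L : ℝ)⁻¹) ^ (K - j))⁻¹ := rfl
  rw [hadd, hβ, Real.sq_sqrt hx.le, mul_comm _ ((F.L : ℝ) ^ j), mul_assoc, inv_mul_cancel₀ hx.ne', mul_one]

/-- `Cc·e^{−2Cc} < ½` for every real `Cc` (`e^{x} ≥ 1 + x`). [folklore] -/
theorem mul_exp_neg_two_mul_lt_half (Cc : ℝ) : Cc * Real.exp (-(2 * Cc)) < 1 / 2 := by
  have h1 : 1 + 2 * Cc ≤ Real.exp (2 * Cc) := by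
    have := Real.add_one_le_exp (2 * Cc); linarith
  have hpos : 0 < Real.exp (2 * Cc) := Real.exp_pos _
  rw [Real.exp_neg, ← div_eq_mul_inv, div_lt_iff₀ hpos]
  nlinarith

/-! ## §2 The Gaussian window tail from K1 ∧ K2 ∧ the median row -/

/-- **THE WINDOW TAIL STEP.**  At one instance `(F, γ ≤ ½, K, j, a)` with `j + 2 ≤ K`: the concentration hypothesis `hK1` (text of
`MesoscopicConcentrationL` at `(F,γ,K)`), the window-Lipschitz estimate `hK2` (text of `BlockLipschitzL` at `a`, constant `CL`) and the MEDIAN ROW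
`hMed : ½ ≤ Gibbs_K(G(a,j) ∩ {dist1(Ū^j(∂a)) ≤ m·g_{K−j}})` give, for every level `n ≥ 2(m + (CL+1)√(578·Cc/cc))`,
`Gibbs_K(G(a,j) ∩ {n·g_{K−j} ≤ dist1(Ū^j(∂a))}) ≤ Cc·exp(−(cc/(1156(CL+1)²))·n²)` — a Gaussian tail of the normalised flux on the window,
uniform in `(K, j, a)`.  McShane extension capped at `n·g`; K1 twice (lower tail against the median, upper tail at `n/2`); `β_K g² = L^j`.
[cite: Balaban1985UV3, (3) p.256 and (7) p.257] -/
theorem windowTail_step (F : T3Family) {γ b₀ p₀ : ℝ} (hγ : 0 < γ) (hγ2 : γ ≤ 1 / 2)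
    {K j : ℕ} (hjK : j + 2 ≤ K) (a : Plaq (F.P K) j) {Cc cc CL m : ℝ} (hCc : 0 ≤ Cc) (hcc : 0 < cc) (hCL : 0 ≤ CL)
    (hK1 : ∀ (n : ℕ), 1 ≤ n → (n : ℝ) ≤ (F.scheme ℰp γ).β K → 2 * n ≤ (F.P K).sitesPerDir 0 →
      ∀ (x₀ : Site (F.P K) 0) (f : GaugeField (F.P K) 0 (Matrix.specialUnitaryGroup (Fin 2) ℂ) → ℝ) (Λ : ℝ), 0 < Λ → Measurable f → GaugeField.GaugeInvariant f →
      (∀ U U' : GaugeField (F.P K) 0 (Matrix.specialUnitaryGroup (Fin 2) ℂ), (∀ b : PBond (F.P K) 0, (∀ k, (b.src k - x₀ k).val < n) → (∀ k, (b.tgt k - x₀ k).val < n) → U b = U' b) →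
        f U = f U') →
      (∀ U U' : GaugeField (F.P K) 0 (Matrix.specialUnitaryGroup (Fin 2) ℂ), |f U - f U'| ≤ Λ * Real.sqrt (∑ b : PBond (F.P K) 0, GaugeGroup.dist1 (U b * (U' b)⁻¹) ^ 2)) →
      ∀ r : ℝ, 0 ≤ r → (gibbsK F ℰp γ K).real {U | r ≤ f U - ∫ V, f V ∂(gibbsK F ℰp γ K)} ≤
        Cc * Real.exp (-(cc * (F.scheme ℰp γ).β K * r ^ 2 / ((n : ℝ) ^ 2 * Λ ^ 2))))
    (hK2 : ∀ U U' : GaugeField (F.P K) 0 (Matrix.specialUnitaryGroup (Fin 2) ℂ), (∀ (i : ℕ) (q : Plaq (F.P K) i), i < j → Site.tdist (fun k => ((((q.src k).val * F.L ^ i : ℕ)) : ZMod ((F.P K).sitesPerDir 0))) (fun k => ((((a.src k).val * F.L ^ j : ℕ)) : ZMod ((F.P K).sitesPerDir 0))) + 64 * F.L ^ i ≤ 64 * F.L ^ j → GaugeGroup.dist1 (GaugeField.plaqHol (Averaging.iter (fun i' => BlockAveraging.blockAvg (P := F.P K) (j := i') ℰp) i U) q) < θBal F.L γ b₀ p₀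 (K - i)) → (∀ (i : ℕ) (q : Plaq (F.P K) i), i < j → Site.tdist (fun k => ((((q.src k).val * F.L ^ i : ℕ)) : ZMod ((F.P K).sitesPerDir 0))) (fun k => ((((a.src k).val * F.L ^ j : ℕ)) : ZMod ((F.P K).sitesPerDir 0))) + 64 * F.L ^ i ≤ 64 * F.L ^ j → GaugeGroup.dist1 (GaugeField.plaqHol (Averaging.iter (fun i' => BlockAveraging.blockAvg (P := F.P K) (j := i') ℰp) i U') q) < θBal F.L γ b₀ p₀ (K - i)) →
      |GaugeGroup.dist1 (GaugeField.plaqHol (Averaging.iter (fun i' => BlockAveraging.blockAvg (P := F.P K) (j := i') ℰp) j U) a) - GaugeGroup.dist1 (GaugeField.plaqHol (Averaging.iter (fun i' => BlockAveraging.blockAvg (P := F.P K) (j := i') ℰp) j U') a)| ≤ CL / Real.sqrt ((F.L : ℝ) ^ j) * Real.sqrt (∑ b : PBond (F.P K) 0, if (∀ k, (b.src k - ((((a.src k).val * F.L ^ j : ℕ)) : ZMod ((F.P K).sitesPerDir 0)) + ((8 * F.L ^ j : ℕ) : ZMod ((F.P K).sitesPerDir 0))).val < 17 * F.L ^ j)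 ∧ (∀ k, (b.tgt k - ((((a.src k).val * F.L ^ j : ℕ)) : ZMod ((F.P K).sitesPerDir 0)) + ((8 * F.L ^ j : ℕ) : ZMod ((F.P K).sitesPerDir 0))).val < 17 * F.L ^ j) then GaugeGroup.dist1 (U b * (U' b)⁻¹) ^ 2 else 0))
    (hMed : 1 / 2 ≤ (gibbsK F ℰp γ K).real ({U : GaugeField (F.P K) 0 (Matrix.specialUnitaryGroup (Fin 2) ℂ) | (∀ (i : ℕ) (q : Plaq (F.P K) i), i < j → Site.tdist (fun k => ((((q.src k).val * F.L ^ i : ℕ)) : ZMod ((F.P K).sitesPerDir 0))) (fun k => ((((a.src k).val * F.L ^ j : ℕ)) : ZMod ((F.P K).sitesPerDir 0))) + 64 * F.L ^ i ≤ 64 * F.L ^ j → GaugeGroup.dist1 (GaugeField.plaqHol (Averaging.iter (fun i' => BlockAveraging.blockAvg (P := F.P K) (j := i') ℰp) i U) q) < θBal F.L γ b₀ p₀ (K - i))} ∩ {U | GaugeGroup.dist1 (GaugeField.plaqHol (Averaging.iter (fun i' => BlockAveraging.blockAvg (P := F.P K) (j := i') ℰp) j U) a) ≤ m * Real.sqrt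 (γ * ((F.L : ℝ)⁻¹) ^ (K - j))}))
    (n : ℕ) (hn : 2 * (m + (CL + 1) * Real.sqrt (578 * Cc / cc)) ≤ (n : ℝ)) :
    (gibbsK F ℰp γ K).real ({U : GaugeField (F.P K) 0 (Matrix.specialUnitaryGroup (Fin 2) ℂ) | (∀ (i : ℕ) (q : Plaq (F.P K) i), i < j → Site.tdist (fun k => ((((q.src k).val * F.L ^ i : ℕ)) : ZMod ((F.P K).sitesPerDir 0))) (fun k => ((((a.src k).val * F.L ^ j : ℕ)) : ZMod ((F.P K).sitesPerDir 0))) + 64 * F.L ^ i ≤ 64 * F.L ^ j → GaugeGroup.dist1 (GaugeField.plaqHol (Averaging.iter (fun i' => BlockAveraging.blockAvg (P := F.P K) (j := i') ℰp) i U) q) < θBal F.L γ b₀ p₀ (K - i))} ∩ {U | (n : ℝ) * Real.sqrt (γ * ((F.L : ℝ)⁻¹) ^ (K - j)) ≤ GaugeGroup.dist1 (GaugeField.plaqHol (Averaging.iter (fun i' => BlockAveraging.blockAvg (P := F.P K) (j := i') ℰp) j U) a)}) ≤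
      Cc * Real.exp (-(cc / (1156 * (CL + 1) ^ 2) * (n : ℝ) ^ 2)) := by
  haveI := isProbabilityMeasure_gibbsK F ℰp hγ.le K
  have hL1 : 1 ≤ F.L := F.hL.2.le
  have hL3 : 3 ≤ F.L := by obtain ⟨k, hk⟩ := F.hL.1; have := F.hL.2; omega
  have hLr : (3 : ℝ) ≤ F.L := by exact_mod_cast hL3
  set μ := gibbsK F ℰp γ K with hμ
  set gK := Real.sqrt (γ * ((F.L : ℝ)⁻¹) ^ (K - j)) with hgK
  have hgpos : 0 < gK :=
    Real.sqrt_pos.2 (mul_pos hγ (pow_pos (inv_pos.2 (by exact_mod_cast lt_trans zero_lt_one F.hL.2)) _))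
  have hLj : (0 : ℝ) < (F.L : ℝ) ^ j := by positivity
  have hsq : 0 < Real.sqrt ((F.L : ℝ) ^ j) := Real.sqrt_pos.mpr hLj
  set Λ : ℝ := (CL + 1) / Real.sqrt ((F.L : ℝ) ^ j) with hΛ
  have hΛpos : 0 < Λ := div_pos (by linarith) hsq
  set r₀ : ℝ := (CL + 1) * Real.sqrt (578 * Cc / cc) with hr₀
  have hr₀0 : 0 ≤ r₀ := mul_nonneg (by linarith) (Real.sqrt_nonneg _)
  set θn : ℝ := (n : ℝ) * gK with hθn
  have hθn0 : 0 ≤ θn := mul_nonneg (Nat.cast_nonneg n) hgpos.le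
  set f : GaugeField (F.P K) 0 (Matrix.specialUnitaryGroup (Fin 2) ℂ) → ℝ := fun U => GaugeGroup.dist1 (GaugeField.plaqHol (Averaging.iter (fun i' => BlockAveraging.blockAvg (P := F.P K) (j := i') ℰp) j U) a) with hf
  set G : Set (GaugeField (F.P K) 0 (Matrix.specialUnitaryGroup (Fin 2) ℂ)) := {U : GaugeField (F.P K) 0 (Matrix.specialUnitaryGroup (Fin 2) ℂ) | (∀ (i : ℕ) (q : Plaq (F.P K) i), i < j → Site.tdist (fun k => ((((q.src k).val * F.L ^ i : ℕ)) : ZMod ((F.P K).sitesPerDir 0))) (fun k => ((((a.src k).val * F.L ^ j : ℕ)) : ZMod ((F.P K).sitesPerDir 0))) + 64 * F.L ^ i ≤ 64 * F.L ^ j → GaugeGroup.dist1 (GaugeField.plaqHol (Averaging.iter (fun i' => BlockAveraging.blockAvg (P := F.P K) (j := i') ℰp) i U) q) < θBal F.L γ b₀ p₀ (K - i))} with hG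
  set d : GaugeField (F.P K) 0 (Matrix.specialUnitaryGroup (Fin 2) ℂ) → GaugeField (F.P K) 0 (Matrix.specialUnitaryGroup (Fin 2) ℂ) → ℝ := fun U U' => Real.sqrt (∑ b : PBond (F.P K) 0, if (∀ k, (b.src k - ((((a.src k).val * F.L ^ j : ℕ)) : ZMod ((F.P K).sitesPerDir 0)) + ((8 * F.L ^ j : ℕ) : ZMod ((F.P K).sitesPerDir 0))).val < 17 * F.L ^ j) ∧ (∀ k, (b.tgt k - ((((a.src k).val * F.L ^ j : ℕ)) : ZMod ((F.P K).sitesPerDir 0)) + ((8 * F.L ^ j : ℕ) : ZMod ((F.P K).sitesPerDir 0))).val < 17 * F.L ^ j) then GaugeGroup.dist1 (U b * (U' b)⁻¹) ^ 2 else 0) with hd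
  -- §a the McShane extension capped at `θn = n·g`
  obtain ⟨gn, hg0, hgθ, hgf, hgeq, hgLip, hginv, hgloc, hgmeas⟩ :=
    exists_capped_infConvolution d (fun U U' => boxLinkDist_nonneg _ U U') (fun U => boxLinkDist_self _ U)
      (fun U U' => boxLinkDist_comm _ U U') (fun U U' U'' => boxLinkDist_triangle _ U U' U'')
      (fun U' => continuous_boxLinkDist _ U') G f (fun U => GaugeGroup.dist1_nonneg _) θn Λ hθn0 hΛpos.le
      (fun U hU U' hU' => (hK2 U U' hU hU').trans
        (mul_le_mul_of_nonneg_right (div_le_div_of_nonneg_right (by linarith) hsq.le) (Real.sqrt_nonneg _)))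
      (GaugeField.gaugeAct (P := F.P K) (j := 0) (G := (Matrix.specialUnitaryGroup (Fin 2) ℂ)))
      (fun u U hU => by
        simp only [hG, Set.mem_setOf_eq] at hU ⊢
        intro i q hi hnear
        rw [dist1_plaqHol_iter_gaugeAct F (by omega) q u U]
        exact hU i q hi hnear)
      (fun u U => by simp only [hf]; exact dist1_plaqHol_iter_gaugeAct F (by omega) a u U)
      (fun u U U' => boxLinkDist_gaugeAct _ u U U')
      (fun u => ⟨fun x => (u x)⁻¹, gaugeAct_gaugeAct_inv u⟩)
      (fun U U' => ∀ b : PBond (F.P K) 0, (∀ k, (b.src k - ((((a.src k).val * F.L ^ j : ℕ)) : ZMod ((F.P K).sitesPerDir 0)) + ((8 * F.L ^ j : ℕ) : ZMod ((F.P K).sitesPerDir 0))).val < 17 * F.L ^ j) ∧ (∀ k, (b.tgt k - ((((a.src k).val * F.L ^ j : ℕ)) : ZMod ((F.P K).sitesPerDir 0)) + ((8 * F.L ^ j : ℕ) : ZMod ((F.P K).sitesPerDir 0))).val < 17 * F.L ^ j) → U b = U' b)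
      (fun U U' h V => boxLinkDist_congr_left _ h V)
  have hgn_int : Integrable gn μ :=
    Integrable.mono' (integrable_const θn) hgmeas.aestronglyMeasurable
      (ae_of_all _ fun U => by rw [Real.norm_eq_abs, abs_of_nonneg (hg0 U)]; exact hgθ U)
  set E : ℝ := ∫ V, gn V ∂μ with hE
  -- §b the box: side `17 L^j`, corner `corner(a) L^j − 8 L^j`
  have h1n : 1 ≤ 17 * F.L ^ j := by
    have : 1 ≤ F.L ^ j := Nat.one_le_pow _ _ (by omega)
    omega
  have h2n : 2 * (17 * F.L ^ j) ≤ (F.P K).sitesPerDir 0 := by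
    have hN0 : (F.P K).sitesPerDir 0 = 2 * F.L ^ (F.m + K) := by simp [Params.sitesPerDir]
    rw [hN0]
    have hsplit : F.L ^ (F.m + K) = F.L ^ j * F.L ^ (F.m + K - j) := by rw [← pow_add]; congr 1; omega
    have h27 : 27 ≤ F.L ^ (F.m + K - j) :=
      calc 27 = 3 ^ 3 := by norm_num
        _ ≤ F.L ^ 3 := Nat.pow_le_pow_left hL3 3
        _ ≤ F.L ^ (F.m + K - j) := Nat.pow_le_pow_right (by omega) (by have := F.hm; omega)
    rw [hsplit]
    nlinarith
  have hβK : (F.scheme ℰp γ).β K = (F.L : ℝ) ^ K / γ := by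
    show (γ * (F.P K).eps)⁻¹ = _
    have heps : (F.P K).eps = ((F.L : ℝ)⁻¹) ^ K := rfl
    rw [heps, mul_inv, inv_pow, inv_inv, div_eq_inv_mul]
  have hnβ : ((17 * F.L ^ j : ℕ) : ℝ) ≤ (F.scheme ℰp γ).β K := by
    rw [hβK, le_div_iff₀ hγ]
    push_cast
    have hsplit : (F.L : ℝ) ^ K = (F.L : ℝ) ^ j * (F.L : ℝ) ^ (K - j) := by rw [← pow_add]; congr 1; omega
    have h9 : (9 : ℝ) ≤ (F.L : ℝ) ^ (K - j) :=
      calc (9 : ℝ) = 3 ^ 2 := by norm_num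
        _ ≤ (F.L : ℝ) ^ 2 := pow_le_pow_left₀ (by norm_num) hLr 2
        _ ≤ (F.L : ℝ) ^ (K - j) := pow_le_pow_right₀ (by linarith) (by omega)
    rw [hsplit]
    nlinarith
  set x₀ : Site (F.P K) 0 := fun k => ((((a.src k).val * F.L ^ j : ℕ)) : ZMod ((F.P K).sitesPerDir 0)) - ((8 * F.L ^ j : ℕ) : ZMod ((F.P K).sitesPerDir 0)) with hx₀
  have hbox : ∀ U U' : GaugeField (F.P K) 0 (Matrix.specialUnitaryGroup (Fin 2) ℂ), (∀ b : PBond (F.P K) 0, (∀ k, (b.src k - x₀ k).val < 17 * F.L ^ j) →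
      (∀ k, (b.tgt k - x₀ k).val < 17 * F.L ^ j) → U b = U' b) → gn U = gn U' := by
    intro U U' h
    refine hgloc U U' fun b hb => h b (fun k => ?_) (fun k => ?_)
    · have hk : b.src k - x₀ k = b.src k - ((((a.src k).val * F.L ^ j : ℕ)) : ZMod ((F.P K).sitesPerDir 0)) + ((8 * F.L ^ j : ℕ) : ZMod ((F.P K).sitesPerDir 0)) := by
        simp only [hx₀]; ring
      rw [hk]; exact hb.1 k
    · have hk : b.tgt k - x₀ k = b.tgt k - ((((a.src k).val * F.L ^ j : ℕ)) : ZMod ((F.P K).sitesPerDir 0)) + ((8 * F.L ^ j : ℕ) : ZMod ((F.P K).sitesPerDir 0)) := by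
        simp only [hx₀]; ring
      rw [hk]; exact hb.2 k
  have hLipg : ∀ U U' : GaugeField (F.P K) 0 (Matrix.specialUnitaryGroup (Fin 2) ℂ), |gn U - gn U'| ≤
      Λ * Real.sqrt (∑ b : PBond (F.P K) 0, GaugeGroup.dist1 (U b * (U' b)⁻¹) ^ 2) :=
    fun U U' => (hgLip U U').trans (mul_le_mul_of_nonneg_left (boxLinkDist_le_linkDist _ U U') hΛpos.le)
  -- the same data for `−gn`
  have hbox' : ∀ U U' : GaugeField (F.P K) 0 (Matrix.specialUnitaryGroup (Fin 2) ℂ), (∀ b : PBond (F.P K) 0, (∀ k, (b.src k - x₀ k).val < 17 * F.L ^ j) →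
      (∀ k, (b.tgt k - x₀ k).val < 17 * F.L ^ j) → U b = U' b) → (fun V => -gn V) U = (fun V => -gn V) U' :=
    fun U U' h => by simp only [hbox U U' h]
  have hLipg' : ∀ U U' : GaugeField (F.P K) 0 (Matrix.specialUnitaryGroup (Fin 2) ℂ), |(fun V => -gn V) U - (fun V => -gn V) U'| ≤
      Λ * Real.sqrt (∑ b : PBond (F.P K) 0, GaugeGroup.dist1 (U b * (U' b)⁻¹) ^ 2) := by
    intro U U'
    have h := hLipg U U'
    rwa [show (fun V => -gn V) U - (fun V => -gn V) U' = -(gn U - gn U') by ring, abs_neg]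
  have hginv' : GaugeField.GaugeInvariant (fun V => -gn V) := fun u U => by simp only [hginv u U]
  -- §c the exponent: `cc β_K (s g)² / ((17L^j)² Λ²) = (cc/(289 (CL+1)²)) s²`
  have hβg : (F.scheme ℰp γ).β K * gK ^ 2 = (F.L : ℝ) ^ j := beta_mul_coupling_sq F hγ (by omega)
  have hnΛ : (((17 * F.L ^ j : ℕ)) : ℝ) ^ 2 * Λ ^ 2 = 289 * (CL + 1) ^ 2 * (F.L : ℝ) ^ j := by
    rw [hΛ, div_pow, Real.sq_sqrt hLj.le]
    push_cast
    field_simp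
    ring
  have hCL1 : (CL + 1) ≠ 0 := by linarith
  have hexp : ∀ s : ℝ, cc * (F.scheme ℰp γ).β K * (s * gK) ^ 2 / ((((17 * F.L ^ j : ℕ)) : ℝ) ^ 2 * Λ ^ 2) =
      cc / (289 * (CL + 1) ^ 2) * s ^ 2 := by
    intro s
    have h1 : cc * (F.scheme ℰp γ).β K * (s * gK) ^ 2 = cc * s ^ 2 * ((F.scheme ℰp γ).β K * gK ^ 2) := by ring
    rw [h1, hβg, hnΛ]
    field_simp
  -- §d the mean of `gn` from the median row and the LOWER tail
  have hEle : E ≤ (m + r₀) * gK := by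
    by_contra H
    push Not at H
    have hK := hK1 (17 * F.L ^ j) h1n hnβ h2n x₀ (fun V => -gn V) Λ hΛpos hgmeas.neg hginv' hbox' hLipg' (r₀ * gK)
      (mul_nonneg hr₀0 hgpos.le)
    rw [hexp r₀] at hK
    have hEneg : ∫ V, (fun V => -gn V) V ∂μ = -E := by simp only [hE]; exact integral_neg gn
    rw [hEneg] at hK
    have hsub : G ∩ {U : GaugeField (F.P K) 0 (Matrix.specialUnitaryGroup (Fin 2) ℂ) | f U ≤ m * gK} ⊆
        {U | r₀ * gK ≤ (fun V => -gn V) U - -E} := by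
      rintro U ⟨hUG, hUf⟩
      simp only [Set.mem_setOf_eq] at hUf ⊢
      have h1 : gn U ≤ f U := hgf U hUG
      have h2 : (m + r₀) * gK = m * gK + r₀ * gK := by ring
      linarith
    have hr₀sq : cc / (289 * (CL + 1) ^ 2) * r₀ ^ 2 = 2 * Cc := by
      rw [hr₀, mul_pow, Real.sq_sqrt (by positivity)]
      field_simp
      ring
    rw [hr₀sq] at hK
    have hchain : (1 : ℝ) / 2 ≤ Cc * Real.exp (-(2 * Cc)) :=
      calc (1 : ℝ) / 2 ≤ μ.real (G ∩ {U | f U ≤ m * gK}) := hMed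
        _ ≤ μ.real {U | r₀ * gK ≤ (fun V => -gn V) U - -E} := measureReal_mono hsub (measure_ne_top _ _)
        _ ≤ Cc * Real.exp (-(2 * Cc)) := hK
    linarith [mul_exp_neg_two_mul_lt_half Cc]
  -- §e the UPPER tail at `s = n/2`
  have hsub : G ∩ {U : GaugeField (F.P K) 0 (Matrix.specialUnitaryGroup (Fin 2) ℂ) | θn ≤ f U} ⊆ {U | (n : ℝ) / 2 * gK ≤ gn U - E} := by
    rintro U ⟨hUG, hUf⟩
    simp only [Set.mem_setOf_eq] at hUf ⊢
    rw [hgeq U hUG hUf, hθn]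
    have h1 : 2 * (m + r₀) * gK ≤ (n : ℝ) * gK := mul_le_mul_of_nonneg_right hn hgpos.le
    have h2 : 2 * (m + r₀) * gK = 2 * ((m + r₀) * gK) := by ring
    have h3 : (n : ℝ) / 2 * gK = (n : ℝ) * gK / 2 := by ring
    rw [h3]
    linarith
  have hK := hK1 (17 * F.L ^ j) h1n hnβ h2n x₀ gn Λ hΛpos hgmeas hginv hbox hLipg ((n : ℝ) / 2 * gK) (by positivity)
  rw [hexp ((n : ℝ) / 2)] at hK
  have hcoef : cc / (289 * (CL + 1) ^ 2) * ((n : ℝ) / 2) ^ 2 = cc / (1156 * (CL + 1) ^ 2) * (n : ℝ) ^ 2 := by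
    field_simp; ring
  rw [hcoef] at hK
  have hset : ({U : GaugeField (F.P K) 0 (Matrix.specialUnitaryGroup (Fin 2) ℂ) | (∀ (i : ℕ) (q : Plaq (F.P K) i), i < j → Site.tdist (fun k => ((((q.src k).val * F.L ^ i : ℕ)) : ZMod ((F.P K).sitesPerDir 0))) (fun k => ((((a.src k).val * F.L ^ j : ℕ)) : ZMod ((F.P K).sitesPerDir 0))) + 64 * F.L ^ i ≤ 64 * F.L ^ j → GaugeGroup.dist1 (GaugeField.plaqHol (Averaging.iter (fun i' => BlockAveraging.blockAvg (P := F.P K) (j := i') ℰp) i U) q) < θBal F.L γ b₀ p₀ (K - i))} ∩ {U | (n : ℝ) * Real.sqrt (γ * ((F.L : ℝ)⁻¹) ^ (K - j)) ≤ GaugeGroup.dist1 (GaugeField.plaqHol (Averaging.iter (fun i' => BlockAveraging.blockAvg (P := F.P K) (j := i') ℰp) j U) a)}) = G ∩ {U | θn ≤ f U} := by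
    simp only [hG, hθn, hf, hgK]
  calc μ.real ({U : GaugeField (F.P K) 0 (Matrix.specialUnitaryGroup (Fin 2) ℂ) | (∀ (i : ℕ) (q : Plaq (F.P K) i), i < j → Site.tdist (fun k => ((((q.src k).val * F.L ^ i : ℕ)) : ZMod ((F.P K).sitesPerDir 0))) (fun k => ((((a.src k).val * F.L ^ j : ℕ)) : ZMod ((F.P K).sitesPerDir 0))) + 64 * F.L ^ i ≤ 64 * F.L ^ j → GaugeGroup.dist1 (GaugeField.plaqHol (Averaging.iter (fun i' => BlockAveraging.blockAvg (P := F.P K) (j := i') ℰp) i U) q) < θBal F.L γ b₀ p₀ (K - i))} ∩ {U | (n : ℝ) * Real.sqrt (γ * ((F.L : ℝ)⁻¹) ^ (K - j)) ≤ GaugeGroup.dist1 (GaugeField.plaqHol (Averaging.iter (fun i' => BlockAveraging.blockAvg (P := F.P K) (j := i') ℰp) j U) a)})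
      = μ.real (G ∩ {U | θn ≤ f U}) := by rw [hset]
    _ ≤ μ.real {U | (n : ℝ) / 2 * gK ≤ gn U - E} := measureReal_mono hsub (measure_ne_top _ _)
    _ ≤ Cc * Real.exp (-(cc / (1156 * (CL + 1) ^ 2) * (n : ℝ) ^ 2)) := hK

/-! ## §3 The mean form of the centring row gives the median row (Markov) -/

/-- **MEAN AT SCALE `g` ⇒ MEDIAN AT SCALE `g`.**  If `∫ dist1(Ū^j(∂a)) ∂Gibbs_K ≤ (m/4)·g_{K−j}` (`m > 0`) and `Gibbs_K(G(a,j)ᶜ) ≤ ¼`, then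
`½ ≤ Gibbs_K(G(a,j) ∩ {dist1(Ū^j(∂a)) ≤ m·g_{K−j}})` (Markov: `Gibbs_K{m·g ≤ dist1} ≤ ¼`). [cite: Balaban1985UV3, (7) p.257] -/
theorem median_of_mean (F : T3Family) {γ b₀ p₀ : ℝ} (hγ : 0 < γ) {K j : ℕ} (a : Plaq (F.P K) j) {m : ℝ} (hm : 0 < m)
    (hMean : ∫ U, GaugeGroup.dist1 (GaugeField.plaqHol (Averaging.iter (fun i' => BlockAveraging.blockAvg (P := F.P K) (j := i') ℰp) j U) a) ∂(gibbsK F ℰp γ K) ≤ m / 4 * Real.sqrt (γ * ((F.L : ℝ)⁻¹) ^ (K - j)))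
    (hGc : (gibbsK F ℰp γ K).real {U : GaugeField (F.P K) 0 (Matrix.specialUnitaryGroup (Fin 2) ℂ) | (∀ (i : ℕ) (q : Plaq (F.P K) i), i < j → Site.tdist (fun k => ((((q.src k).val * F.L ^ i : ℕ)) : ZMod ((F.P K).sitesPerDir 0))) (fun k => ((((a.src k).val * F.L ^ j : ℕ)) : ZMod ((F.P K).sitesPerDir 0))) + 64 * F.L ^ i ≤ 64 * F.L ^ j → GaugeGroup.dist1 (GaugeField.plaqHol (Averaging.iter (fun i' => BlockAveraging.blockAvg (P := F.P K) (j := i') ℰp) i U) q) < θBal F.L γ b₀ p₀ (K - i))}ᶜ ≤ 1 / 4) :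
    1 / 2 ≤ (gibbsK F ℰp γ K).real ({U : GaugeField (F.P K) 0 (Matrix.specialUnitaryGroup (Fin 2) ℂ) | (∀ (i : ℕ) (q : Plaq (F.P K) i), i < j → Site.tdist (fun k => ((((q.src k).val * F.L ^ i : ℕ)) : ZMod ((F.P K).sitesPerDir 0))) (fun k => ((((a.src k).val * F.L ^ j : ℕ)) : ZMod ((F.P K).sitesPerDir 0))) + 64 * F.L ^ i ≤ 64 * F.L ^ j → GaugeGroup.dist1 (GaugeField.plaqHol (Averaging.iter (fun i' => BlockAveraging.blockAvg (P := F.P K) (j := i') ℰp) i U) q) < θBal F.L γ b₀ p₀ (K - i))} ∩ {U | GaugeGroup.dist1 (GaugeField.plaqHol (Averaging.iter (fun i' => BlockAveraging.blockAvg (P := F.P K) (j := i') ℰp) j U) a) ≤ m * Real.sqrt (γ * ((F.L : ℝ)⁻¹) ^ (K - j))}) := by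
  haveI := isProbabilityMeasure_gibbsK F ℰp hγ.le K
  set μ := gibbsK F ℰp γ K with hμ
  set gK := Real.sqrt (γ * ((F.L : ℝ)⁻¹) ^ (K - j)) with hgK
  have hgpos : 0 < gK :=
    Real.sqrt_pos.2 (mul_pos hγ (pow_pos (inv_pos.2 (by exact_mod_cast lt_trans zero_lt_one F.hL.2)) _))
  set f : GaugeField (F.P K) 0 (Matrix.specialUnitaryGroup (Fin 2) ℂ) → ℝ := fun U => GaugeGroup.dist1 (GaugeField.plaqHol (Averaging.iter (fun i' => BlockAveraging.blockAvg (P := F.P K) (j := i') ℰp) j U) a) with hf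
  set G : Set (GaugeField (F.P K) 0 (Matrix.specialUnitaryGroup (Fin 2) ℂ)) := {U : GaugeField (F.P K) 0 (Matrix.specialUnitaryGroup (Fin 2) ℂ) | (∀ (i : ℕ) (q : Plaq (F.P K) i), i < j → Site.tdist (fun k => ((((q.src k).val * F.L ^ i : ℕ)) : ZMod ((F.P K).sitesPerDir 0))) (fun k => ((((a.src k).val * F.L ^ j : ℕ)) : ZMod ((F.P K).sitesPerDir 0))) + 64 * F.L ^ i ≤ 64 * F.L ^ j → GaugeGroup.dist1 (GaugeField.plaqHol (Averaging.iter (fun i' => BlockAveraging.blockAvg (P := F.P K) (j := i') ℰp) i U) q) < θBal F.L γ b₀ p₀ (K - i))} with hG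
  have hf_meas : Measurable f := measurable_flux F K j a
  have hf_int : Integrable f μ :=
    Integrable.mono' (integrable_const (2 : ℝ)) hf_meas.aestronglyMeasurable
      (ae_of_all _ fun U => by
        rw [Real.norm_eq_abs, abs_of_nonneg (GaugeGroup.dist1_nonneg _)]
        exact dist1_le_two_specialUnitaryGroup _)
  have hG_meas : MeasurableSet G := measurableSet_localGood F (fun i => θBal F.L γ b₀ p₀ (K - i)) K j
      (fun i q => Site.tdist (fun k => ((((q.src k).val * F.L ^ i : ℕ)) : ZMod ((F.P K).sitesPerDir 0))) (fun k => ((((a.src k).val * F.L ^ j : ℕ)) : ZMod ((F.P K).sitesPerDir 0))) + 64 * F.L ^ i ≤ 64 * F.L ^ j)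
  have hS_meas : MeasurableSet {U | f U ≤ m * gK} := measurableSet_le hf_meas measurable_const
  -- Markov
  have hmg : 0 < m * gK := mul_pos hm hgpos
  have hMarkov : μ.real {U | m * gK ≤ f U} ≤ 1 / 4 := by
    have h := mul_meas_ge_le_integral_of_nonneg (ae_of_all _ fun U => GaugeGroup.dist1_nonneg _) hf_int (m * gK)
    have h2 : (m * gK) * μ.real {U | m * gK ≤ f U} ≤ m / 4 * gK := h.trans hMean
    have h3 : μ.real {U | m * gK ≤ f U} ≤ (m / 4 * gK) / (m * gK) := by rw [le_div_iff₀ hmg]; linarith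
    have h4 : (m / 4 * gK) / (m * gK) = 1 / 4 := by field_simp
    linarith
  -- complement bound
  have hcompl : (G ∩ {U | f U ≤ m * gK})ᶜ ⊆ Gᶜ ∪ {U | m * gK ≤ f U} := by
    intro U hU
    rw [Set.mem_compl_iff, Set.mem_inter_iff, not_and_or] at hU
    rcases hU with h | h
    · exact Or.inl h
    · right
      simp only [Set.mem_setOf_eq, not_le] at h ⊢
      exact h.le
  have h1 : μ.real (G ∩ {U | f U ≤ m * gK}) + μ.real (G ∩ {U | f U ≤ m * gK})ᶜ = 1 :=
    probReal_add_probReal_compl (hG_meas.inter hS_meas)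
  have h2 : μ.real (G ∩ {U | f U ≤ m * gK})ᶜ ≤ μ.real Gᶜ + μ.real {U | m * gK ≤ f U} :=
    (measureReal_mono hcompl (measure_ne_top _ _)).trans (measureReal_union_le _ _)
  have h3 : μ.real Gᶜ ≤ 1 / 4 := hGc
  linarith

end Summit.QuantumFields.YangMills.Theorems.LocalInsertion.WindowTailOfConcentration
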